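import Literature.Analysis.FluidPDE.KatoLocalLerayPressure
import HarnessLib

/-!
# Time plateaux as smooth windows: the edge kernels, their unit masses, and product test
# functions `η(t) χ(x)`

Analysis/FluidPDE support file (theorems only, no definitions or named facts) for the energy
estimate of the caloric remainder of Kato's mild `L³` solution up to the blow-up time (Calderón /
Rusin–Šverák route to `Literature.Analysis.FluidPDE.IsKatoSolutionOn.farField_bound`; W. Rusin,
V. Šverák, J. Funct. Anal. 260 (2011) = arXiv:0911.0500, §4 p. 6; P. G. Lemarié-Rieusset, *The
Navier–Stokes problem in the 21st century* (2016), proof of Thm. 14.7 p. 518 and proof of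
Thm. 14.2 p. 499: "apply the local energy inequality to the test function `φ(s,x) = γ(s)φ₀(x)`").
Testing a local energy inequality with the product `γ(s)φ₀(x)` of the tree's time plateau
`σ_{δ,L} = timePlateau δ L` (`KatoLocalLerayPressure.lean`: `σ = 1` on `[2δ, L - 2δ]`, `σ = 0` off
`(δ, L - δ)`) and letting `δ → 0` produces the time slices `∫ |w(t)|² φ₀` at the two edges of the
plateau; this file records the elementary facts behind that passage to the limit:

* `deriv_smoothTransition_eq_zero_of_notMem_Icc` — `ST' = 0` off `[0, 1]`;
* the **edge kernels** `((1 / δ) * deriv smoothTransition ((s - δ) / δ)) = δ⁻¹ ST'((s-δ)/δ) ≥ 0` (supported in `[δ, 2δ]`) and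
  `((1 / δ) * deriv smoothTransition ((L - δ - s) / δ)) = δ⁻¹ ST'((L-δ-s)/δ) ≥ 0` (supported in `[L-2δ, L-δ]`), continuous, of unit
  mass (`integral_plateauRise`, `integral_plateauFall`, fundamental theorem of calculus), with
  **`σ' = plateauRise - plateauFall`** for `0 < δ`, `4δ ≤ L` (`deriv_timePlateau_eq_rise_sub_fall`);
* the **approximate identity** `∫ κₖ g → g(t₀)` for continuous nonnegative unit-mass kernels
  concentrating at a point of continuity of a locally integrable `g`
  (`tendsto_integral_kernel_mul_of_continuousAt`; the two-sided twin of the tree's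
  `tendsto_integral_kernel_mul_of_continuousWithinAt`, `LocalEnergyFinalIdentity.lean`);
* **product test functions** `(t, x) ↦ η(t) χ(x)` on a slab `(T₁, T₂) × E` for a smooth `η`
  supported in `[t₁, t₂] ⊂ (T₁, T₂)` and a smooth compactly supported `χ`
  (`isSpaceTimeTestOn_mul_of_support_subset`), with `∂ₜ(ηχ) = η'χ`, `D(ηχ)(t) = η(t) Dχ`,
  `∇(ηχ)(t) = η(t) ∇χ`, `Δ(ηχ)(t) = η(t) Δχ`.

## Mathlib / tree search

Tree: `timePlateau`, `hasDerivAt_smoothTransition_rise`, `hasDerivAt_smoothTransition_fall`,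
`timePlateau_eq_zero_of_le/ge`, `contDiff_timePlateau` (`KatoLocalLerayPressure.lean`); the left-sided
kernel lemma `tendsto_integral_kernel_mul_of_continuousWithinAt` (`LocalEnergyFinalIdentity.lean`,
not imported: Seregin's local-energy class is not needed here). Mathlib: `Real.smoothTransition`
(`zero_of_nonpos`, `one_of_one_le`, `contDiff`, `monotone`), `Filter.EventuallyEq.deriv_eq`,
`intervalIntegral.integral_eq_sub_of_hasDerivAt`, `setIntegral_eq_integral_of_forall_compl_eq_zero`,
`InnerProductSpace.laplacian_smul`.

## References

* W. Rusin, V. Šverák, J. Funct. Anal. 260 (2011) 879–891 = arXiv:0911.0500, §4 p. 6.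
  [RusinSverak2011]
* P. G. Lemarié-Rieusset, *The Navier–Stokes problem in the 21st century*, CRC Press 2016,
  Thm. 14.2 (proof, p. 499), Thm. 14.7 (proof, p. 518). [LemarieRieusset2016]
-/

noncomputable section

open MeasureTheory TopologicalSpace Set Function Filter Topology Metric Real
open scoped ENNReal NNReal RealInnerProductSpace Laplacian

namespace Literature.Analysis.FluidPDE

/-! ### `ST' = 0` off `[0, 1]` -/

/-- The derivative of `Real.smoothTransition` vanishes off `[0, 1]` (the function is locally
constant there). [folklore] -/
theorem deriv_smoothTransition_eq_zero_of_notMem_Icc {x : ℝ} (hx : x ∉ Icc (0 : ℝ) 1) :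
    deriv smoothTransition x = 0 := by
  rw [mem_Icc, not_and_or, not_le, not_le] at hx
  rcases hx with hx | hx
  · have hev : smoothTransition =ᶠ[𝓝 x] fun _ => (0 : ℝ) := by
      filter_upwards [(isOpen_gt' (0 : ℝ)).mem_nhds hx] with y hy
      exact smoothTransition.zero_of_nonpos (le_of_lt hy)
    rw [hev.deriv_eq, deriv_const]
  · have hev : smoothTransition =ᶠ[𝓝 x] fun _ => (1 : ℝ) := by
      filter_upwards [(isOpen_lt' (1 : ℝ)).mem_nhds hx] with y hy
      exact smoothTransition.one_of_one_le (le_of_lt hy)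
    rw [hev.deriv_eq, deriv_const]

/-! ### The edge kernels of the time plateau -/

section Kernels

variable {δ L : ℝ}

/-- `ρ⁺ ≥ 0` for `δ > 0`. [folklore] -/
theorem plateauRise_nonneg (hδ : 0 < δ) (s : ℝ) : 0 ≤ ((1 / δ) * deriv smoothTransition ((s - δ) / δ)) :=
  mul_nonneg (by positivity) smoothTransition.monotone.deriv_nonneg

/-- `ρ⁻ ≥ 0` for `δ > 0`. [folklore] -/
theorem plateauFall_nonneg (hδ : 0 < δ) (L s : ℝ) : 0 ≤ ((1 / δ) * deriv smoothTransition ((L - δ - s) / δ)) :=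
  mul_nonneg (by positivity) smoothTransition.monotone.deriv_nonneg

/-- `ρ⁺` is continuous. [folklore] -/
theorem continuous_plateauRise (δ : ℝ) : Continuous fun s => ((1 / δ) * deriv smoothTransition ((s - δ) / δ)) := by
  have hc : Continuous (deriv smoothTransition) :=
    (smoothTransition.contDiff (n := 1)).continuous_deriv le_rfl
  exact continuous_const.mul (hc.comp ((continuous_id.sub continuous_const).div_const δ))

/-- `ρ⁻` is continuous. [folklore] -/
theorem continuous_plateauFall (δ L : ℝ) : Continuous fun s => ((1 / δ) * deriv smoothTransition ((L - δ - s) / δ)) := by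
  have hc : Continuous (deriv smoothTransition) :=
    (smoothTransition.contDiff (n := 1)).continuous_deriv le_rfl
  exact continuous_const.mul (hc.comp ((continuous_const.sub continuous_id).div_const δ))

/-- `ρ⁺ + ρ⁻ = timePlateauRate` (the tree's majorant of `|σ'|`). [folklore] -/
theorem plateauRise_add_plateauFall (δ L s : ℝ) :
    ((1 / δ) * deriv smoothTransition ((s - δ) / δ)) + ((1 / δ) * deriv smoothTransition ((L - δ - s) / δ)) = timePlateauRate δ L s := by
  simp only [timePlateauRate]
  ring

/-- `ρ⁺` is supported in `[δ, 2δ]` (`δ > 0`). [folklore] -/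
theorem plateauRise_eq_zero_of_notMem (hδ : 0 < δ) {s : ℝ} (hs : s ∉ Icc δ (2 * δ)) :
    ((1 / δ) * deriv smoothTransition ((s - δ) / δ)) = 0 := by
  rw [mem_Icc, not_and_or, not_le, not_le] at hs
  rcases hs with h | h
  · rw [deriv_smoothTransition_eq_zero_of_notMem_Icc, mul_zero]
    exact fun h' => by have := h'.1; rw [le_div_iff₀ hδ] at this; linarith
  · rw [deriv_smoothTransition_eq_zero_of_notMem_Icc, mul_zero]
    exact fun h' => by have := h'.2; rw [div_le_iff₀ hδ] at this; linarith

/-- `ρ⁻` is supported in `[L - 2δ, L - δ]` (`δ > 0`). [folklore] -/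
theorem plateauFall_eq_zero_of_notMem (hδ : 0 < δ) {s : ℝ} (hs : s ∉ Icc (L - 2 * δ) (L - δ)) :
    ((1 / δ) * deriv smoothTransition ((L - δ - s) / δ)) = 0 := by
  rw [mem_Icc, not_and_or, not_le, not_le] at hs
  rcases hs with h | h
  · rw [deriv_smoothTransition_eq_zero_of_notMem_Icc, mul_zero]
    exact fun h' => by have := h'.2; rw [div_le_iff₀ hδ] at this; linarith
  · rw [deriv_smoothTransition_eq_zero_of_notMem_Icc, mul_zero]
    exact fun h' => by have := h'.1; rw [le_div_iff₀ hδ] at this; linarith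

/-- **`σ' = ρ⁺ - ρ⁻`** for `0 < δ`, `4δ ≤ L`: on the support of `ρ⁺` the falling factor equals `1`,
on the support of `ρ⁻` the rising factor equals `1`. [folklore] -/
theorem deriv_timePlateau_eq_rise_sub_fall (hδ : 0 < δ) (hL : 4 * δ ≤ L) (s : ℝ) :
    deriv (timePlateau δ L) s = ((1 / δ) * deriv smoothTransition ((s - δ) / δ)) - ((1 / δ) * deriv smoothTransition ((L - δ - s) / δ)) := by
  have hA := hasDerivAt_smoothTransition_rise δ s
  have hB := hasDerivAt_smoothTransition_fall δ L s
  have h : HasDerivAt (timePlateau δ L) _ s := hA.mul hB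
  rw [h.deriv]
  have eF : deriv smoothTransition ((L - δ - s) / δ) * (-1 / δ) = -((1 / δ) * deriv smoothTransition ((L - δ - s) / δ)) := by
    ring
  have eR : deriv smoothTransition ((s - δ) / δ) * (1 / δ) = ((1 / δ) * deriv smoothTransition ((s - δ) / δ)) := by
    ring
  rw [eF, eR]
  rcases le_or_gt s (2 * δ) with hs | hs
  · -- `s ≤ 2δ ≤ L - 2δ`: the falling factor is `1`
    have hB1 : smoothTransition ((L - δ - s) / δ) = 1 :=
      smoothTransition.one_of_one_le (by rw [le_div_iff₀ hδ]; linarith)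
    rw [hB1, mul_one]
    by_cases hs' : s < L - 2 * δ
    · rw [plateauFall_eq_zero_of_notMem hδ (fun h' => by linarith [h'.1])]
      ring
    · -- then `s = 2δ = L - 2δ` and the rising factor is `1` as well
      have hA1 : smoothTransition ((s - δ) / δ) = 1 :=
        smoothTransition.one_of_one_le (by rw [le_div_iff₀ hδ]; linarith)
      rw [hA1]
      ring
  · -- `s > 2δ`: the rising factor is `1` and `ρ⁺(s) = 0`
    have hA1 : smoothTransition ((s - δ) / δ) = 1 :=
      smoothTransition.one_of_one_le (by rw [le_div_iff₀ hδ]; linarith)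
    have hR0 : ((1 / δ) * deriv smoothTransition ((s - δ) / δ)) = 0 := plateauRise_eq_zero_of_notMem hδ fun h' => by linarith [h'.2]
    rw [hA1, hR0]
    ring

/-- **`∫ ρ⁺ = 1`** (`δ > 0`): `ρ⁺` is the derivative of the rising factor, which climbs from
`ST(0) = 0` at `s = δ` to `ST(1) = 1` at `s = 2δ`. [folklore] -/
theorem integral_plateauRise (hδ : 0 < δ) : ∫ s, ((1 / δ) * deriv smoothTransition ((s - δ) / δ)) = 1 := by
  have hderiv : ∀ s, HasDerivAt (fun s => smoothTransition ((s - δ) / δ)) (((1 / δ) * deriv smoothTransition ((s - δ) / δ))) s := by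
    intro s
    refine (hasDerivAt_smoothTransition_rise δ s).congr_deriv ?_
    ring
  rw [← setIntegral_eq_integral_of_forall_compl_eq_zero (s := Icc δ (2 * δ))
    (fun s hs => plateauRise_eq_zero_of_notMem hδ hs), integral_Icc_eq_integral_Ioc,
    ← intervalIntegral.integral_of_le (by linarith),
    intervalIntegral.integral_eq_sub_of_hasDerivAt (fun s _ => hderiv s)
      ((continuous_plateauRise δ).intervalIntegrable _ _)]
  have h1 : smoothTransition ((2 * δ - δ) / δ) = 1 :=
    smoothTransition.one_of_one_le (by rw [le_div_iff₀ hδ]; linarith)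
  have h0 : smoothTransition ((δ - δ) / δ) = 0 :=
    smoothTransition.zero_of_nonpos (by rw [sub_self, zero_div])
  rw [h1, h0, sub_zero]

/-- **`∫ ρ⁻ = 1`** (`δ > 0`): `-ρ⁻` is the derivative of the falling factor, which descends from
`1` at `s = L - 2δ` to `0` at `s = L - δ`. [folklore] -/
theorem integral_plateauFall (hδ : 0 < δ) (L : ℝ) : ∫ s, ((1 / δ) * deriv smoothTransition ((L - δ - s) / δ)) = 1 := by
  have hderiv : ∀ s, HasDerivAt (fun s => -smoothTransition ((L - δ - s) / δ)) (((1 / δ) * deriv smoothTransition ((L - δ - s) / δ))) s := by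
    intro s
    refine (hasDerivAt_smoothTransition_fall δ L s).neg.congr_deriv ?_
    ring
  rw [← setIntegral_eq_integral_of_forall_compl_eq_zero (s := Icc (L - 2 * δ) (L - δ))
    (fun s hs => plateauFall_eq_zero_of_notMem hδ hs), integral_Icc_eq_integral_Ioc,
    ← intervalIntegral.integral_of_le (by linarith),
    intervalIntegral.integral_eq_sub_of_hasDerivAt (fun s _ => hderiv s)
      ((continuous_plateauFall δ L).intervalIntegrable _ _)]
  have h1 : smoothTransition ((L - δ - (L - 2 * δ)) / δ) = 1 :=
    smoothTransition.one_of_one_le (by rw [le_div_iff₀ hδ]; linarith)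
  have h0 : smoothTransition ((L - δ - (L - δ)) / δ) = 0 :=
    smoothTransition.zero_of_nonpos (by rw [sub_self, zero_div])
  rw [h1, h0]
  ring

end Kernels

/-! ### Approximate identity at a point of continuity -/

/-- **Approximate identity against a continuous function, two-sided.** Let `g` be integrable on
`[t₀ - 1, t₀ + 1]` and continuous at `t₀`, and let `κₖ ≥ 0` be continuous unit-mass kernels
supported in `[t₀ - cₖ, t₀ + cₖ]` with `cₖ ≤ 1`, `cₖ → 0`. Then `∫ κₖ g → g(t₀)`. [folklore] -/
theorem tendsto_integral_kernel_mul_of_continuousAt {g : ℝ → ℝ} {t₀ : ℝ}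
    (hg : ContinuousAt g t₀) (hgi : IntegrableOn g (Icc (t₀ - 1) (t₀ + 1)) volume)
    {κ : ℕ → ℝ → ℝ} {c : ℕ → ℝ} (hc1 : ∀ k, c k ≤ 1)
    (hc : Tendsto c atTop (𝓝 0)) (hκc : ∀ k, Continuous (κ k)) (hκ0 : ∀ k t, 0 ≤ κ k t)
    (hκsupp : ∀ k t, κ k t ≠ 0 → t ∈ Icc (t₀ - c k) (t₀ + c k)) (hκ1 : ∀ k, ∫ t, κ k t = 1) :
    Tendsto (fun k => ∫ t, κ k t * g t) atTop (𝓝 (g t₀)) := by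
  rw [Metric.tendsto_atTop]
  intro ε hε
  obtain ⟨d, hd, hdg⟩ := Metric.continuousAt_iff.1 hg (ε / 2) (half_pos hε)
  obtain ⟨N, hN⟩ := eventually_atTop.1 ((tendsto_order.1 hc).2 d hd)
  refine ⟨N, fun k hk => ?_⟩
  have hk' : c k < d := hN k hk
  -- support and boundedness of the kernel
  have hsupp : support (κ k) ⊆ Icc (t₀ - c k) (t₀ + c k) := fun t ht => hκsupp k t ht
  have hsuppIcc : Icc (t₀ - c k) (t₀ + c k) ⊆ Icc (t₀ - 1) (t₀ + 1) :=
    Icc_subset_Icc (by linarith [hc1 k]) (by linarith [hc1 k])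
  have hκcs : HasCompactSupport (κ k) :=
    HasCompactSupport.of_support_subset_isCompact isCompact_Icc hsupp
  obtain ⟨C, hC⟩ := (hκc k).bounded_above_of_compact_support hκcs
  -- integrability of `κ g` and `κ`
  have hκi : Integrable (κ k) volume := (hκc k).integrable_of_hasCompactSupport hκcs
  have hκgi : Integrable (fun t => κ k t * g t) volume := by
    have h1 : IntegrableOn (fun t => κ k t * g t) (Icc (t₀ - 1) (t₀ + 1)) volume :=
      hgi.bdd_mul (hκc k).aestronglyMeasurable.restrict (Eventually.of_forall fun t => hC t)
    refine (integrableOn_iff_integrable_of_support_subset ?_).1 h1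
    intro t ht
    exact hsuppIcc (hsupp (left_ne_zero_of_mul (mem_support.1 ht)))
  -- the estimate
  have hdiff : (∫ t, κ k t * g t) - g t₀ = ∫ t, κ k t * (g t - g t₀) := by
    have e1 : (fun t => κ k t * (g t - g t₀)) = fun t => κ k t * g t - κ k t * g t₀ := by
      funext t; ring
    rw [e1, integral_sub hκgi (hκi.mul_const _), integral_mul_const, hκ1 k, one_mul]
  rw [Real.dist_eq, hdiff]
  have hpt : ∀ t, |κ k t * (g t - g t₀)| ≤ κ k t * (ε / 2) := by
    intro t
    by_cases ht : κ k t = 0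
    · rw [ht, zero_mul, zero_mul, abs_zero]
    · have htI := hκsupp k t ht
      have hdist : dist t t₀ < d := by
        rw [Real.dist_eq, abs_lt]
        constructor <;> linarith [htI.1, htI.2]
      have hlt : dist (g t) (g t₀) < ε / 2 := hdg hdist
      rw [Real.dist_eq] at hlt
      rw [abs_mul, abs_of_nonneg (hκ0 k t)]
      exact mul_le_mul_of_nonneg_left hlt.le (hκ0 k t)
  calc |∫ t, κ k t * (g t - g t₀)| ≤ ∫ t, |κ k t * (g t - g t₀)| := by
        rw [← Real.norm_eq_abs]
        exact (norm_integral_le_integral_norm _).trans_eq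
          (integral_congr_ae (Eventually.of_forall fun t => Real.norm_eq_abs _))
    _ ≤ ∫ t, κ k t * (ε / 2) :=
        integral_mono_of_nonneg (Eventually.of_forall fun t => abs_nonneg _)
          (hκi.mul_const _) (Eventually.of_forall hpt)
    _ = ε / 2 := by rw [integral_mul_const, hκ1 k, one_mul]
    _ < ε := half_lt_self hε

/-! ### Product test functions `η(t) χ(x)` -/

section Product

variable {E : Type*} [NormedAddCommGroup E] [InnerProductSpace ℝ E] [FiniteDimensional ℝ E]

omit [InnerProductSpace ℝ E] [FiniteDimensional ℝ E] in
variable [NormedSpace ℝ E] in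
/-- **`η(t) χ(x)` is a space–time test function on the slab `(T₁, T₂) × E`** when `η` is smooth and
supported in `[t₁, t₂] ⊂ (T₁, T₂)` and `χ` is smooth with compact support. [folklore] -/
theorem isSpaceTimeTestOn_mul_of_support_subset {η : ℝ → ℝ} {χ : E → ℝ} {T₁ T₂ t₁ t₂ : ℝ}
    (hη : ContDiff ℝ (⊤ : ℕ∞) η) (hηs : support η ⊆ Icc t₁ t₂) (h₁ : T₁ < t₁) (h₂ : t₂ < T₂)
    (hχ : ContDiff ℝ (⊤ : ℕ∞) χ) (hχc : HasCompactSupport χ) :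
    IsSpaceTimeTestOn (slab E (Ioo T₁ T₂) isOpen_Ioo) fun t x => η t * χ x where
  contDiff := (hη.comp contDiff_fst).mul (hχ.comp contDiff_snd)
  hasCompactSupport := by
    refine HasCompactSupport.of_support_subset_isCompact ((isCompact_Icc (a := t₁) (b := t₂)).prod hχc) ?_
    intro z hz
    rw [mem_support] at hz
    exact ⟨hηs (left_ne_zero_of_mul hz), subset_tsupport _ (right_ne_zero_of_mul hz)⟩
  tsupport_subset := by
    have hsub : support (uncurry fun t x => η t * χ x) ⊆ Icc t₁ t₂ ×ˢ tsupport χ := by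
      intro z hz
      rw [mem_support] at hz
      exact ⟨hηs (left_ne_zero_of_mul hz), subset_tsupport _ (right_ne_zero_of_mul hz)⟩
    refine (closure_minimal hsub (isClosed_Icc.prod (isClosed_tsupport _))).trans fun z hz => ?_
    rw [coe_slab]
    exact ⟨⟨h₁.trans_le hz.1.1, hz.1.2.trans_lt h₂⟩, mem_univ _⟩

omit [NormedAddCommGroup E] [InnerProductSpace ℝ E] [FiniteDimensional ℝ E] in
/-- `∂ₜ(η χ) = η'(t) χ(x)`. [folklore] -/
theorem timeDeriv_mul_const_space {η : ℝ → ℝ} (χ : E → ℝ) (hη : Differentiable ℝ η) (t : ℝ) (x : E) :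
    timeDeriv (fun s y => η s * χ y) t x = deriv η t * χ x := by
  rw [timeDeriv_apply]
  exact deriv_mul_const (hη t) _

omit [InnerProductSpace ℝ E] [FiniteDimensional ℝ E] in
variable [NormedSpace ℝ E] in
/-- `D(η χ)(t) = η(t) Dχ` at points of differentiability of `χ`. [folklore] -/
theorem fderiv_mul_const_time (η : ℝ → ℝ) {χ : E → ℝ} (t : ℝ) {x : E} (hχ : DifferentiableAt ℝ χ x) :
    fderiv ℝ (fun y => η t * χ y) x = η t • fderiv ℝ χ x :=
  fderiv_const_mul hχ (η t)

/-- `∇(η χ)(t) = η(t) ∇χ` at points of differentiability of `χ`. [folklore] -/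
theorem gradient_mul_const_time (η : ℝ → ℝ) {χ : E → ℝ} (t : ℝ) {x : E} (hχ : DifferentiableAt ℝ χ x) :
    gradient (fun y => η t * χ y) x = η t • gradient χ x := by
  rw [gradient, gradient, fderiv_mul_const_time η t hχ, map_smul]

/-- `Δ(η χ)(t) = η(t) Δχ` for `χ ∈ C²`. [folklore] -/
theorem laplacian_mul_const_time (η : ℝ → ℝ) {χ : E → ℝ} (hχ : ContDiff ℝ 2 χ) (t : ℝ) (x : E) :
    (Δ (fun y => η t * χ y)) x = η t * (Δ χ) x := by
  have h1 : (fun y => η t * χ y) = η t • χ := by funext y; simp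
  rw [h1, InnerProductSpace.laplacian_smul _ hχ.contDiffAt, smul_eq_mul]

end Product

end Literature.Analysis.FluidPDE
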